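import Summits.ABC.ABC.Theorems.TowerFourSubLiouville.Negative.AnchoredSliceCorner
import Summits.ABC.ABC.Theorems.TowerFourSubLiouville.Negative.AxisBoundary

/-!
# `TowerFourSubLiouville` (stmt-ABC-1649): the staircase corner `(θ, φ) = (1, 2)` of the two-exponent diagram is FALSE —
the `(1;1,2)` identity twisted `5`-adically

Negative-side module of the standing disprover (cycle 15, refuter-cdisprove-stmt-ABC-1649-g15-0, 2026-08-17), companion of
`Negative.AnchoredSliceCorner` (p141423: the tight `ℙ¹` identity `(s+2)(2s−1)⁴ − (s−2)(2s+1)⁴ = 80s² + 4` on `s = 6m + 3`, corner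
`(1, 2)`: height `w = s + 2 ≤ Z = 2s − 1`, value `80s² + 4 ≈ 20·Z²`, hence `¬ UBQ₂`-type statements only for `φ > 2`) and of
`Negative.AxisBoundary` (p152685: the closed lobe `{θ ≥ 2, φ ≥ 0}`).

The typed matrices carry the constant `1` (`max(v,w) ≤ Z^θ`, `Z^φ < |wZ⁴ − vY⁴|`), so a family decides a BOUNDARY point only if its
constants are `≤ 1`.  ARITHMETIC TWIST: on the residue class `s ≡ −2 (mod 5⁴)` the coefficient `w = s + 2` carries a fourth power
`5⁴`, which moves into `Z`:  `w' := (s+2)/5⁴`, `Z' := 5(2s − 1)`, same `v = s − 2`, `Y = 2s + 1`, same value `a = 80s² + 4`; now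
`max(v, w') = v ≈ Z'/10 ≤ Z'` and `a ≈ 0.8·Z'² ≤ Z'²`.  With the coprimality class `s ≡ 3 (mod 6)` of p141423 this is
`s = 3750j + 3123` (`s + 2 = 5⁴(6j + 5)`), i.e. the INTEGER identity

  `(6j + 5)·(37500j + 31225)⁴ = (3750j + 3121)·(7500j + 6247)⁴ + (80(3750j + 3123)² + 4)`   (`anchoredFamily5_identity`, `ring`),

coprime because `w'Z' ∣ wZ` (`anchoredFamily_coprime (625j + 520)`).  First member (`j = 0`): `5·31225⁴ − 3121·6247⁴ = 780250324 < 31225²`.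
Consequences (matrices verbatim):
* `not_ubq₂_of_one_le_of_two_le`: **`UBQ₂(θ, φ)` is FALSE for every `θ ≥ 1`, `φ ≥ 2`** — new exactly at the staircase corner `(1, 2)`
  (`not_ubq₂_one_two`), the meeting point of the lobes `{θ > 1, φ > 3/2}` and `{θ > 0, φ > 2}`;
* `not_ubqOn_anchoredSlice_of_two_le`: the strategist's anchored slice Dc2 (p141423: false for `η > 2`, `B ≥ 1`) is false AT `η = 2`
  for `B ≥ 5` — the twisted family is anchored at `(p, q) = (1, 5)`: `|1⁴·v − 5⁴·w'| = 4`, `2·4² ≤ 5⁴ w'`;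
* `ubq₂_false_of_corner₈`: proved FALSE region `{θ ≥ 2, φ ≥ 0} ∪ {θ ≥ 1, φ ≥ 2} ∪ {θ > 1, φ > 3/2} ∪ {θ > 0, φ > 2}`.
Staircase `(0,2)–(1,2)–(1,3/2)–(2,3/2)–(2,0)` after cycle 15: `(0,2)` TRUE (column `θ = 0`, p137751), `(1,2)` FALSE (here), `(2,3/2)`, `(2,0)`
FALSE (p152685); `(1, 3/2)` (padeFamily₂, constants `w ≈ 2Z`, value `≈ 950·Z^{3/2}`) needs a twist by `q⁴ ∣ 20(s+1)² + 1` with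
`q^{3/2} > 950` — open.  Calibration, not a kill.
-/

-- `Summit.ABC.ABC` is the mandated summit-side namespace (CONVENTIONS §2); the duplicate is deliberate.
set_option linter.dupNamespace false

namespace Summit.ABC.ABC.Theorems.TowerFourSubLiouville.Negative

/-! ## The twisted `(1;1,2)` family -/

/-- The `(1;1,2)` identity on `s = 3750j + 3123` with `5⁴ ∣ s + 2` absorbed into `Z`: an INTEGER polynomial identity. -/
theorem anchoredFamily5_identity (j : ℕ) :
    (6 * j + 5) * (37500 * j + 31225) ^ 4
      = (3750 * j + 3121) * (7500 * j + 6247) ^ 4 + (80 * (3750 * j + 3123) ^ 2 + 4) := by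
  ring

/-- Coprimality `gcd(vY, w'Z') = 1`: `w'Z'` divides the `wZ` of `anchoredFamily_coprime` at `m = 625j + 520`. -/
theorem anchoredFamily5_coprime (j : ℕ) :
    Nat.Coprime ((3750 * j + 3121) * (7500 * j + 6247)) ((6 * j + 5) * (37500 * j + 31225)) := by
  have h := anchoredFamily_coprime (625 * j + 520)
  have h1 : (6 * (625 * j + 520) + 1) * (12 * (625 * j + 520) + 7) = (3750 * j + 3121) * (7500 * j + 6247) := by ring
  have h2 : (6 * (625 * j + 520) + 5) * (12 * (625 * j + 520) + 5) = 125 * ((6 * j + 5) * (37500 * j + 31225)) := by ring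
  rw [h1, h2] at h
  exact h.coprime_dvd_right (Dvd.intro_left 125 rfl)

/-- The value is below `Z'²` (indeed `≈ 0.8·Z'²`): `(37500j + 31225)² = a + (281250000j² + 468075000j + 194750301)`. -/
theorem anchoredFamily5_value_le (j : ℕ) :
    80 * (3750 * j + 3123) ^ 2 + 4 ≤ (37500 * j + 31225) ^ 2 := by
  have : (37500 * j + 31225) ^ 2
      = (80 * (3750 * j + 3123) ^ 2 + 4) + (281250000 * j ^ 2 + 468075000 * j + 194750301) := by ring
  omega

/-- **The family packaged**: beyond every bound a coprime quadruple with `wZ⁴ = vY⁴ + a`, `0 < a ≤ Z²`, height `max(v, w) = v ≤ Z`,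
anchored at `(1, 5)`: `625·w = v + 4`. -/
theorem exists_anchoredFamily5 (N : ℕ) : ∃ v w Y Z a : ℕ, N ≤ Z ∧ 0 < v ∧ 0 < w ∧ 0 < Y ∧ 1 ≤ Z ∧
    Nat.Coprime (v * Y) (w * Z) ∧ w * Z ^ 4 = v * Y ^ 4 + a ∧ 0 < a ∧ a ≤ Z ^ 2 ∧ w ≤ v ∧ v ≤ Z ∧ 625 * w = v + 4 := by
  refine ⟨3750 * N + 3121, 6 * N + 5, 7500 * N + 6247, 37500 * N + 31225, 80 * (3750 * N + 3123) ^ 2 + 4,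
    by omega, by omega, by omega, by omega, by omega, anchoredFamily5_coprime N, anchoredFamily5_identity N,
    by positivity, anchoredFamily5_value_le N, by omega, by omega, by ring⟩

/-- The first member: `5·31225⁴ − 3121·6247⁴ = 780250324 = 80·3123² + 4 < 31225² = 975000625`, `gcd = 1`, height `3121 ≤ 31225`. -/
example : (5 : ℕ) * 31225 ^ 4 = 3121 * 6247 ^ 4 + 780250324 ∧ (780250324 : ℕ) = 80 * 3123 ^ 2 + 4 ∧
    (780250324 : ℕ) < 31225 ^ 2 ∧ Nat.gcd (3121 * 6247) (5 * 31225) = 1 := by norm_num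

/-! ## The corner `(1, 2)` -/

/-- **`UBQ₂(θ, φ)` fails for every `θ ≥ 1` and every `φ ≥ 2`** — new exactly at the staircase corner `(1, 2)`. -/
theorem not_ubq₂_of_one_le_of_two_le (θ φ : ℝ) (hθ : 1 ≤ θ) (hφ : 2 ≤ φ) :
    ¬ ∃ Z₀ : ℕ, ∀ v w Y Z : ℕ, Z₀ ≤ Z → 0 < v → 0 < w → 0 < Y → Nat.Coprime (v * Y) (w * Z) →
      ((max v w : ℕ) : ℝ) ≤ (Z : ℝ) ^ θ → w * Z ^ 4 ≠ v * Y ^ 4 →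
      (Z : ℝ) ^ φ < |((w * Z ^ 4 : ℕ) : ℝ) - ((v * Y ^ 4 : ℕ) : ℝ)| := by
  rintro ⟨Z₀, h⟩
  obtain ⟨v, w, Y, Z, a, hNZ, hv, hw, hY, hZ1, hcop, hid, ha, haZ, hwv, hvZ, -⟩ := exists_anchoredFamily5 Z₀
  have hZR : (1 : ℝ) ≤ Z := by exact_mod_cast hZ1
  have hmax : ((max v w : ℕ) : ℝ) ≤ (Z : ℝ) ^ θ := by
    rw [max_eq_left hwv]
    calc (v : ℝ) ≤ (Z : ℝ) := by exact_mod_cast hvZ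
      _ = (Z : ℝ) ^ (1 : ℝ) := (Real.rpow_one _).symm
      _ ≤ (Z : ℝ) ^ θ := Real.rpow_le_rpow_of_exponent_le hZR hθ
  have hne : w * Z ^ 4 ≠ v * Y ^ 4 := by rw [hid]; omega
  have key := h v w Y Z hNZ hv hw hY hcop hmax hne
  have habs : |((w * Z ^ 4 : ℕ) : ℝ) - ((v * Y ^ 4 : ℕ) : ℝ)| = (a : ℝ) := by
    rw [hid]; push_cast
    rw [show (((v : ℝ) * (Y : ℝ) ^ 4 + (a : ℝ)) - (v : ℝ) * (Y : ℝ) ^ 4) = (a : ℝ) by ring]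
    exact abs_of_nonneg (by positivity)
  rw [habs] at key
  have haR : (a : ℝ) ≤ (Z : ℝ) ^ (2 : ℕ) := by
    have : ((a : ℕ) : ℝ) ≤ ((Z ^ 2 : ℕ) : ℝ) := by exact_mod_cast haZ
    push_cast at this; exact this
  have h2 : (Z : ℝ) ^ (2 : ℕ) ≤ (Z : ℝ) ^ φ := by
    rw [← Real.rpow_natCast]
    exact Real.rpow_le_rpow_of_exponent_le hZR (by exact_mod_cast hφ)
  linarith

/-- **The staircase corner `(1, 2)` itself is false.** -/
theorem not_ubq₂_one_two :
    ¬ ∃ Z₀ : ℕ, ∀ v w Y Z : ℕ, Z₀ ≤ Z → 0 < v → 0 < w → 0 < Y → Nat.Coprime (v * Y) (w * Z) →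
      ((max v w : ℕ) : ℝ) ≤ (Z : ℝ) ^ (1:ℝ) → w * Z ^ 4 ≠ v * Y ^ 4 →
      (Z : ℝ) ^ (2:ℝ) < |((w * Z ^ 4 : ℕ) : ℝ) - ((v * Y ^ 4 : ℕ) : ℝ)| :=
  not_ubq₂_of_one_le_of_two_le 1 2 le_rfl le_rfl

/-- **The proved FALSE region after cycle 15** (two closed lobes, two open ones):
`{θ ≥ 2, φ ≥ 0} ∪ {θ ≥ 1, φ ≥ 2} ∪ {θ > 1, φ > 3/2} ∪ {θ > 0, φ > 2}`. -/
theorem ubq₂_false_of_corner₈ {θ φ : ℝ}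
    (hc : (2 ≤ θ ∧ 0 ≤ φ) ∨ (1 ≤ θ ∧ 2 ≤ φ) ∨ (1 < θ ∧ 3 / 2 < φ) ∨ (0 < θ ∧ 2 < φ)) :
    ¬ ∃ Z₀ : ℕ, ∀ v w Y Z : ℕ, Z₀ ≤ Z → 0 < v → 0 < w → 0 < Y → Nat.Coprime (v * Y) (w * Z) →
      ((max v w : ℕ) : ℝ) ≤ (Z : ℝ) ^ θ → w * Z ^ 4 ≠ v * Y ^ 4 →
      (Z : ℝ) ^ φ < |((w * Z ^ 4 : ℕ) : ℝ) - ((v * Y ^ 4 : ℕ) : ℝ)| := by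
  rcases hc with ⟨hθ, hφ⟩ | ⟨hθ, hφ⟩ | hc
  · exact not_ubq₂_of_two_le θ φ hθ hφ
  · exact not_ubq₂_of_one_le_of_two_le θ φ hθ hφ
  · exact ubq₂_false_of_corner₇ (Or.inr hc)

/-! ## The anchored slice at its pin -/

/-- **Dc2 at `η = 2`**: the ON-piece `UBQOn (anchoredSlice B) η` of the strategist's anchored split (matrix verbatim, p141423)
is FALSE for every `B ≥ 5` and every `η ≥ 2` — the twisted family is anchored at `(p, q) = (1, 5)` (`625w = v + 4`). -/
theorem not_ubqOn_anchoredSlice_of_two_le (B : ℕ) (hB : 5 ≤ B) (η : ℝ) (hη : 2 ≤ η) :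
    ¬ ∃ Z₀ : ℕ, ∀ v w Y Z : ℕ, Z₀ ≤ Z →
      (∃ p q : ℕ, 0 < p ∧ 0 < q ∧ p ≤ B ∧ q ≤ B ∧ p ^ 4 * v ≠ q ^ 4 * w ∧
        2 * (((p ^ 4 * v : ℕ) : ℤ) - ((q ^ 4 * w : ℕ) : ℤ)).natAbs ^ 2 ≤ q ^ 4 * w) →
      0 < v → 0 < w → 0 < Y → Nat.Coprime (v * Y) (w * Z) →
      ((max v w : ℕ) : ℝ) ≤ (Z : ℝ) ^ η → w * Z ^ 4 ≠ v * Y ^ 4 →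
      (Z : ℝ) ^ η < |((w * Z ^ 4 : ℕ) : ℝ) - ((v * Y ^ 4 : ℕ) : ℝ)| := by
  rintro ⟨Z₀, h⟩
  obtain ⟨v, w, Y, Z, a, hNZ, hv, hw, hY, hZ1, hcop, hid, ha, haZ, hwv, hvZ, hanch⟩ := exists_anchoredFamily5 Z₀
  have hZR : (1 : ℝ) ≤ Z := by exact_mod_cast hZ1
  -- the anchor `(p, q) = (1, 5)`
  have hanchor : ∃ p q : ℕ, 0 < p ∧ 0 < q ∧ p ≤ B ∧ q ≤ B ∧ p ^ 4 * v ≠ q ^ 4 * w ∧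
      2 * (((p ^ 4 * v : ℕ) : ℤ) - ((q ^ 4 * w : ℕ) : ℤ)).natAbs ^ 2 ≤ q ^ 4 * w := by
    refine ⟨1, 5, one_pos, by norm_num, le_trans (by norm_num) hB, hB, ?_, ?_⟩
    · norm_num; omega
    · have hdiff : (((1 ^ 4 * v : ℕ) : ℤ) - ((5 ^ 4 * w : ℕ) : ℤ)) = -4 := by
        push_cast
        have : ((625 * w : ℕ) : ℤ) = ((v + 4 : ℕ) : ℤ) := by exact_mod_cast hanch
        push_cast at this
        linarith
      rw [hdiff]
      show 2 * Int.natAbs (-4) ^ 2 ≤ 5 ^ 4 * w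
      norm_num
      omega
  have hmax : ((max v w : ℕ) : ℝ) ≤ (Z : ℝ) ^ η := by
    rw [max_eq_left hwv]
    calc (v : ℝ) ≤ (Z : ℝ) := by exact_mod_cast hvZ
      _ = (Z : ℝ) ^ (1 : ℝ) := (Real.rpow_one _).symm
      _ ≤ (Z : ℝ) ^ η := Real.rpow_le_rpow_of_exponent_le hZR (by linarith)
  have hne : w * Z ^ 4 ≠ v * Y ^ 4 := by rw [hid]; omega
  have key := h v w Y Z hNZ hanchor hv hw hY hcop hmax hne
  have habs : |((w * Z ^ 4 : ℕ) : ℝ) - ((v * Y ^ 4 : ℕ) : ℝ)| = (a : ℝ) := by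
    rw [hid]; push_cast
    rw [show (((v : ℝ) * (Y : ℝ) ^ 4 + (a : ℝ)) - (v : ℝ) * (Y : ℝ) ^ 4) = (a : ℝ) by ring]
    exact abs_of_nonneg (by positivity)
  rw [habs] at key
  have haR : (a : ℝ) ≤ (Z : ℝ) ^ (2 : ℕ) := by
    have : ((a : ℕ) : ℝ) ≤ ((Z ^ 2 : ℕ) : ℝ) := by exact_mod_cast haZ
    push_cast at this; exact this
  have h2 : (Z : ℝ) ^ (2 : ℕ) ≤ (Z : ℝ) ^ η := by
    rw [← Real.rpow_natCast]
    exact Real.rpow_le_rpow_of_exponent_le hZR (by exact_mod_cast hη)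
  linarith

end Summit.ABC.ABC.Theorems.TowerFourSubLiouville.Negative
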